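import Literature.NumberTheory.Rogawski1990.ArchChartOrbGIsolatePlace   -- ★ (J-iso) p851229 (F0P3a-p07 (g18)): ONE place isolated; brings ★ (A1) `ArchChartOrbGSplitCompactProduct`, ★ `InvariantQuotientCompactSubgroup`, ★ G1∕G2
import HarnessLib

/-!
# `chartOrbG` with a FINITE SET of compact-chart places isolated at once: the isolated places become ONE whole-group orbital integral over `Π_{w ∈ T} U(α)_w`
# of the partial chart-orbital integral over the remaining places («(J-iso)^T FINSET ISOLATION»; Folland 1995 §2.2, §2.6 (2.52); Rogawski 1990 §8.2–8.3)

Topic `NumberTheory/Rogawski1990`; namespaces `Literature.MeasureTheory.Group` (§0, generic) and `Literature.NumberTheory.Automorphic.UnitaryGroup` (§1–§2).  THEOREMS ONLY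
(no `def`, no instance, no notation, no axiom, no named fact, no `sorry`).  Cell `pub/hodgecm-mathlib`, crux H413 (`stmt-HodgeConjecture-24833`), F0∕P3c line LH3 (closer stub
`stub_N9`, DIRECT ROAD `F0_P3c_StubN9Direct`, LEAF v5.1), organ O-L1d′ «MIXED SCALAR CORNERS» (`hCm`): the «whole-group blocks at SEVERAL compact places» identity for the
(hCm-ASM) two-stage peeling (LH3-plan (g4) RULING #19, 2026-09-02T11:22:21Z), seat F0P3a-p05 (g21).  Count-neutral measure-theoretic bookkeeping: nothing here closes an organ.

THE MATHEMATICS.  ★ (A1) `chartOrbG_eq_prod_mul_integral_pi` writes the normalised orbital-integral chart family `chartOrbG L α ν′ S′ a′ c` of `G′_∞ ≃ Π_w U(α)_w` (admissible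
label `S′`, product-measure convention `ν′ = e⁻¹_* ⊗_w ν′_w`, any inversion-invariant Haar family `t_w` on the local chart tori `T′_{S′,w}`) as ONE integral over
`Π_w (U(α)_w ⧸ T′_{S′,w})` against `⊗_w (ν′_w ∕ t_w)`.  For ANY decidable predicate `p` on the complex places (the consumer's `p := (· ∈ T)` for a `Finset T`, or «the singular
compact places of the point `x`») split the index set as `{p} ⊔ {¬p}` (Mathlib `MeasurableEquiv.piEquivPiSubtypeProd … p`, the INLINE device of ★ (A1) §2 and ★ (J-iso) §1;
no new definition) and apply Fubini (the `Integrable` binder, discharged at `c ∈ RegG S′`, `a′ ∈ C_c(G′_∞)` by ★ (A1) §4):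
* §1 **`chartOrbG_eq_prod_mul_integral_integral_isolate_pred`** (binder form) ∕ **`…_of_regG`**: the `p`-places OUTSIDE, the `¬p`-places INSIDE —
  `chartOrbG ν′ S′ a′ c = (Π_w t_w(B′_w)) · ∫_{Π_{p}(U_w ⧸ T′_w)} ( ∫_{Π_{¬p}(U_w ⧸ T′_w)} a′ (e⁻¹ (z_w γ_w(c) z_w⁻¹)_w) d(⊗_{¬p} ν′_w∕t_w) ) d(⊗_{p} ν′_w∕t_w)`.
When every `p`-place is a COMPACT-chart place (`hp : p w → w ∉ S′`, so `T′_{S′,w}` is compact, ★ `compactSpace_chartTorusGLoc_of_not_mem`) the product of the local invariant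
quotient measures over the `p`-places is `(Π_{p} t_w(T′_w))⁻¹ • (π_p)_* ⊗_{p} ν′_w` AS A MEASURE (§0 `pi_quotientMeasure_eq_prod_inv_smul_map_pi` = ★ `quotientMeasure_eq_inv_smul_map_mk`
under `Measure.pi`, by Mathlib `Measure.pi_eq`; ALL isolated places convert at once — no place-by-place induction, no nested subtypes), and the box factors
`t_w(B′_w) = t_w(T′_w)` (★ `chartBoxImgGLoc_eq_univ_of_not_mem`) CANCEL:
* §2 **`chartOrbG_eq_prod_mul_integral_pi_group_isolate_of_forall_not_mem`** (THE HEAD):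
  `chartOrbG ν′ S′ a′ c = (Π_{¬p} t_w(B′_w)) · ∫_{Π_{p} U(α)_w} Θ_c((g_w · γ_w(c) · g_w⁻¹)_{p}) d(⊗_{p} ν′_w)(g)`,
  `Θ_c(x) = ∫_{Π_{¬p}(U_w ⧸ T′_w)} a′ (e⁻¹ (x, (ḃ_w γ_w(c) ḃ_w⁻¹)_{¬p})) d(⊗_{¬p} ν′_w∕t_w)` — every `t_w`, `p w`, is GONE.  At `p := (· = w₀)` this is ★ (J-iso) §2
  `chartOrbG_eq_prod_mul_integral_group_isolate_of_not_mem` up to Mathlib `piUnique` (not restated here).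
HONEST LABEL: HC_CM is proved only modulo the 7 printed citations (2 remaining: hLiu418 = `stmt-HodgeConjecture-24832`, h413 = `stmt-HodgeConjecture-24833`) until rung 0
closes; this file moves no row of the books.

## References
* [Folland1995] G. B. Folland, *A Course in Abstract Harmonic Analysis* (1995), §2.2 (product measures), §2.6 Thm. 2.49, (2.52) (quotient integral formula).
* [Rogawski1990] J. D. Rogawski, *Automorphic Representations of Unitary Groups in Three Variables*, Ann. of Math. Stud. 123 (1990), §8.2 p. 122, §8.3 p. 124
  (orbital integrals on the regular set, place by place).
* [BorelJacquet1979] A. Borel, H. Jacquet, *Automorphic forms and automorphic representations*, PSPM 33.1 (1979), §4.1 (`G_∞ = Π_v G(F_v)`, product measures).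
* [DeitmarEchterhoff2014] A. Deitmar, S. Echterhoff, *Principles of Harmonic Analysis*, 2nd ed. (2014), Thm. 1.5.3, Cor. 1.5.4, Lemma 9.3.3.
-/

set_option autoImplicit false

noncomputable section

open MeasureTheory MeasureTheory.Measure NumberField NumberField.InfinitePlace Matrix Complex Topology
open Literature.MeasureTheory.Group Literature.NumberTheory.Rogawski1990
open scoped MatrixGroups Matrix Classical ENNReal NNReal

namespace Literature.MeasureTheory.Group

/-! ## §0 (generic) A finite product of invariant quotient measures by COMPACT subgroups is a scalar multiple of the image of the product Haar measure -/

section PiCompact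

variable {ι : Type*} [Fintype ι] {G : ι → Type*} [∀ i, Group (G i)] [∀ i, TopologicalSpace (G i)]
  [∀ i, IsTopologicalGroup (G i)] [∀ i, LocallyCompactSpace (G i)] [∀ i, SecondCountableTopology (G i)] [∀ i, T2Space (G i)]
  [∀ i, MeasurableSpace (G i)] [∀ i, BorelSpace (G i)]
  (K : ∀ i, Subgroup (G i)) (hK : ∀ i, IsClosed (K i : Set (G i))) [∀ i, CompactSpace ↥(K i)]
  (t : ∀ i, Measure ↥(K i)) [∀ i, (t i).IsMulLeftInvariant] [∀ i, IsFiniteMeasureOnCompacts (t i)] [∀ i, (t i).IsOpenPosMeasure]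
  [∀ i, SFinite (t i)] [∀ i, (t i).IsInvInvariant]
  (ν : ∀ i, Measure (G i)) [∀ i, (ν i).IsHaarMeasure] [∀ i, (ν i).IsMulRightInvariant]
  [∀ i, MeasurableSpace (G i ⧸ K i)] [∀ i, BorelSpace (G i ⧸ K i)]

/-- **`⊗_i μ_{G_i/K_i} = (Π_i t_i(K_i))⁻¹ • (π_i)_* ⊗_i ν_i` FOR COMPACT `K_i`**: the product of the invariant quotient measures by compact subgroups is the image of the
product Haar measure under the product of the quotient maps, normalised by the product of the total masses of the subgroup measures (★ `quotientMeasure_eq_inv_smul_map_mk`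
coordinate-wise, assembled by Mathlib `Measure.pi_eq` on boxes). [cite: Folland1995, §2.2; §2.6 Thm. 2.49 and (2.52)] [cite: DeitmarEchterhoff2014, Cor. 1.5.4] -/
theorem pi_quotientMeasure_eq_prod_inv_smul_map_pi :
    Measure.pi (fun i => quotientMeasure (K i) (t i) (hK i) (ν i)) =
      (∏ i, (t i Set.univ)⁻¹) • Measure.map (fun g : (∀ i, G i) => fun i => (QuotientGroup.mk (g i) : G i ⧸ K i)) (Measure.pi ν) := by
  haveI : ∀ i, SigmaFinite (quotientMeasure (K i) (t i) (hK i) (ν i)) := fun i => inferInstance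
  haveI : ∀ i, SigmaFinite (ν i) := fun i => inferInstance
  have hΦ : Measurable (fun g : (∀ i, G i) => fun i => (QuotientGroup.mk (g i) : G i ⧸ K i)) :=
    measurable_pi_iff.mpr fun i => QuotientGroup.continuous_mk.measurable.comp (measurable_pi_apply i)
  refine Measure.pi_eq fun s hs => ?_
  have hpre : (fun g : (∀ i, G i) => fun i => (QuotientGroup.mk (g i) : G i ⧸ K i)) ⁻¹' Set.pi Set.univ s =
      Set.pi Set.univ fun i => (QuotientGroup.mk : G i → G i ⧸ K i) ⁻¹' s i := by
    ext g
    simp only [Set.mem_preimage, Set.mem_pi, Set.mem_univ, true_implies]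
  rw [Measure.smul_apply, Measure.map_apply hΦ (MeasurableSet.univ_pi hs), hpre, Measure.pi_pi, smul_eq_mul, ← Finset.prod_mul_distrib]
  refine Finset.prod_congr rfl fun i _ => ?_
  rw [quotientMeasure_eq_inv_smul_map_mk (K i) (t i) (ν i), Measure.smul_apply, smul_eq_mul,
    Measure.map_apply QuotientGroup.continuous_mk.measurable (hs i)]

/-- **`∫_{Π_i G_i/K_i} F d(⊗_i μ_{G_i/K_i}) = (Π_i t_i(K_i))⁻¹ • ∫_{Π_i G_i} F((g_i K_i)_i) d(⊗_i ν_i)`** for strongly measurable `F`, COMPACT `K_i` (Bochner form of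
`pi_quotientMeasure_eq_prod_inv_smul_map_pi`; the one-factor case is ★ `integral_quotientMeasure_eq_inv_smul`). [cite: Folland1995, §2.6 (2.52)] [cite: DeitmarEchterhoff2014, Cor. 1.5.4] -/
theorem integral_pi_quotientMeasure_eq_inv_smul_integral_pi {E : Type*} [NormedAddCommGroup E] [NormedSpace ℝ E]
    (F : (∀ i, G i ⧸ K i) → E) (hF : StronglyMeasurable F) :
    ∫ y, F y ∂(Measure.pi fun i => quotientMeasure (K i) (t i) (hK i) (ν i)) =
      (∏ i, (t i).real Set.univ)⁻¹ • ∫ g, F (fun i => (QuotientGroup.mk (g i) : G i ⧸ K i)) ∂(Measure.pi ν) := by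
  have hΦ : Measurable (fun g : (∀ i, G i) => fun i => (QuotientGroup.mk (g i) : G i ⧸ K i)) :=
    measurable_pi_iff.mpr fun i => QuotientGroup.continuous_mk.measurable.comp (measurable_pi_apply i)
  rw [pi_quotientMeasure_eq_prod_inv_smul_map_pi K hK t ν, integral_smul_measure, integral_map hΦ.aemeasurable hF.aestronglyMeasurable,
    ENNReal.toReal_prod]
  congr 1
  rw [← Finset.prod_inv_distrib]
  exact Finset.prod_congr rfl fun i _ => by rw [ENNReal.toReal_inv, measureReal_def]

end PiCompact

end Literature.MeasureTheory.Group

namespace Literature.NumberTheory.Automorphic.UnitaryGroup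

section Isolate

variable (L : Type) [Field L] [NumberField L] [IsCMField L] (α : Fin 3 → L) (S' : Finset {w : InfinitePlace L // IsComplex w})
  [∀ w : {w : InfinitePlace L // IsComplex w}, MeasurableSpace ↥(archLocal L 3 (Matrix.diagonal α) w)]
  [∀ w : {w : InfinitePlace L // IsComplex w}, BorelSpace ↥(archLocal L 3 (Matrix.diagonal α) w)]
  -- ★ `locallyCompactSpace_archLocal_three` ∕ ★ `secondCountableTopology_archLocal_three` (theorems, not instances: supplied by the consumer with `haveI`)
  [∀ w : {w : InfinitePlace L // IsComplex w}, LocallyCompactSpace ↥(archLocal L 3 (Matrix.diagonal α) w)]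
  [∀ w : {w : InfinitePlace L // IsComplex w}, SecondCountableTopology ↥(archLocal L 3 (Matrix.diagonal α) w)]
  [MeasurableSpace ↥(arch (↥(maximalRealSubfield L)) L (IsCMField.complexConj L) 3 (Matrix.diagonal α))]
  [BorelSpace ↥(arch (↥(maximalRealSubfield L)) L (IsCMField.complexConj L) 3 (Matrix.diagonal α))]
  [∀ w : {w : InfinitePlace L // IsComplex w}, MeasurableSpace (↥(archLocal L 3 (Matrix.diagonal α) w) ⧸ chartTorusGLoc L α w S')]
  [∀ w : {w : InfinitePlace L // IsComplex w}, BorelSpace (↥(archLocal L 3 (Matrix.diagonal α) w) ⧸ chartTorusGLoc L α w S')]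
  (ν'w : ∀ w : {w : InfinitePlace L // IsComplex w}, Measure ↥(archLocal L 3 (Matrix.diagonal α) w)) [∀ w, (ν'w w).IsHaarMeasure] [∀ w, (ν'w w).IsMulRightInvariant]
  (ν' : Measure ↥(arch (↥(maximalRealSubfield L)) L (IsCMField.complexConj L) 3 (Matrix.diagonal α))) [ν'.IsHaarMeasure] [ν'.IsMulRightInvariant]
  (hν : ν' = (Measure.pi ν'w).map (archPiEquivCM 3 L (Matrix.diagonal α)).symm)
  (t : ∀ w : {w : InfinitePlace L // IsComplex w}, Measure ↥(chartTorusGLoc L α w S')) [∀ w, (t w).IsHaarMeasure] [∀ w, (t w).IsInvInvariant]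
  -- the isolated places: ANY decidable predicate on the complex places; the `Fintype` instances of the two index subtypes are BINDERS (so that the heads apply verbatim when
  -- `p = (· ∈ T)` for a `Finset T`, whose subtype carries `Finset.Subtype.fintype` — the device of ★ (A1) `measurePreserving_piEquivPiSubtypeProd'`)
  (p : {w : InfinitePlace L // IsComplex w} → Prop) [DecidablePred p]
  [Fintype {w : {w : InfinitePlace L // IsComplex w} // p w}] [Fintype {w : {w : InfinitePlace L // IsComplex w} // ¬ p w}]

/-! ## §1 The quotient form: the `p`-places OUTSIDE, the other places INSIDE (Fubini on ★ (A1) §1) -/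

include hν in
/-- **(J-iso)^T, BINDER FORM — THE PLACES `{w ∣ p w}` ISOLATED** (Fubini on the all-places product form ★ `chartOrbG_eq_prod_mul_integral_pi`): under the `Integrable` binder of the
product-coordinates integrand (discharged at every `c ∈ RegG S′` for `a′ ∈ C_c(G′_∞)` in `…_isolate_pred_of_regG`),
`chartOrbG ν′ S′ a′ c = (Π_w t_w(B′_w)) · ∫_{Π_{p}(U_w⧸T′_w)} ( ∫_{Π_{¬p}(U_w⧸T′_w)} a′ (e⁻¹ (z_w γ_w(c) z_w⁻¹)_w) d(⊗_{¬p} ν′_w∕t_w) ) d(⊗_{p} ν′_w∕t_w)`, `γ_w(c) = gprimeBlockAt α w S′ (c w)`, the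
family `z = (y, b)` assembled by Mathlib's `piEquivPiSubtypeProd … p` (no new definition).
[cite: Folland1995, §2.2; §2.6 (2.52)] [cite: Rogawski1990, §8.2 p. 122; §8.3 p. 124] [cite: BorelJacquet1979, §4.1] [cite: DeitmarEchterhoff2014, Lemma 9.3.3] -/
theorem chartOrbG_eq_prod_mul_integral_integral_isolate_pred (hα : ∀ i, α i ≠ 0) (hS' : ∀ w, w ∈ S' → w ∈ splitChartPlaces L α)
    {a' : ↥(arch (↥(maximalRealSubfield L)) L (IsCMField.complexConj L) 3 (Matrix.diagonal α)) → ℂ}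
    {c : {w : InfinitePlace L // IsComplex w} → Fin 3 → ℝ}
    (hint : Integrable (fun x : (∀ w : {w : InfinitePlace L // IsComplex w}, ↥(archLocal L 3 (Matrix.diagonal α) w) ⧸ chartTorusGLoc L α w S') =>
        a' ((archPiEquivCM 3 L (Matrix.diagonal α)).symm fun w =>
          descConj (gprimeBlockAt L α w S' (c w)) (chartTorusGLoc L α w S') (forall_mem_chartTorusGLoc_comm L α w S' (c w)) id (x w)))
      (Measure.pi fun w => quotientMeasure (chartTorusGLoc L α w S') (t w) (isClosed_chartTorusGLoc L α w S') (ν'w w))) :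
    chartOrbG L α ν' S' a' c =
      (∏ w, ((t w (chartBoxImgGLoc L α w S')).toReal : ℂ)) *
        ∫ y : (∀ w : {w : {w : InfinitePlace L // IsComplex w} // p w}, ↥(archLocal L 3 (Matrix.diagonal α) w.1) ⧸ chartTorusGLoc L α w.1 S'),
          (∫ b : (∀ w' : {w : {w : InfinitePlace L // IsComplex w} // ¬ p w}, ↥(archLocal L 3 (Matrix.diagonal α) w'.1) ⧸ chartTorusGLoc L α w'.1 S'),
            a' ((archPiEquivCM 3 L (Matrix.diagonal α)).symm fun w =>
              descConj (gprimeBlockAt L α w S' (c w)) (chartTorusGLoc L α w S') (forall_mem_chartTorusGLoc_comm L α w S' (c w)) id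
                ((MeasurableEquiv.piEquivPiSubtypeProd
                    (fun w : {w : InfinitePlace L // IsComplex w} => ↥(archLocal L 3 (Matrix.diagonal α) w) ⧸ chartTorusGLoc L α w S') p).symm (y, b) w))
            ∂(Measure.pi fun w' : {w : {w : InfinitePlace L // IsComplex w} // ¬ p w} =>
                quotientMeasure (chartTorusGLoc L α w'.1 S') (t w'.1) (isClosed_chartTorusGLoc L α w'.1 S') (ν'w w'.1)))
          ∂(Measure.pi fun w : {w : {w : InfinitePlace L // IsComplex w} // p w} =>
                quotientMeasure (chartTorusGLoc L α w.1 S') (t w.1) (isClosed_chartTorusGLoc L α w.1 S') (ν'w w.1)) := by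
  haveI : ∀ w : {w : InfinitePlace L // IsComplex w}, IsClosed (chartTorusGLoc L α w S' : Set ↥(archLocal L 3 (Matrix.diagonal α) w)) :=
    fun w => isClosed_chartTorusGLoc L α w S'
  haveI : ∀ w : {w : InfinitePlace L // IsComplex w}, SecondCountableTopology (↥(archLocal L 3 (Matrix.diagonal α) w) ⧸ chartTorusGLoc L α w S') := fun w => inferInstance
  haveI : ∀ w : {w : InfinitePlace L // IsComplex w},
      SigmaFinite (quotientMeasure (chartTorusGLoc L α w S') (t w) (isClosed_chartTorusGLoc L α w S') (ν'w w)) := fun w => inferInstance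
  rw [chartOrbG_eq_prod_mul_integral_pi L α S' ν'w ν' hν t hα hS' a' c]
  congr 1
  -- the integrand on `Π_w (U_w ⧸ T′_w)`
  set F : (∀ w : {w : InfinitePlace L // IsComplex w}, ↥(archLocal L 3 (Matrix.diagonal α) w) ⧸ chartTorusGLoc L α w S') → ℂ :=
    fun x => a' ((archPiEquivCM 3 L (Matrix.diagonal α)).symm fun w =>
      descConj (gprimeBlockAt L α w S' (c w)) (chartTorusGLoc L α w S') (forall_mem_chartTorusGLoc_comm L α w S' (c w)) id (x w)) with hF
  -- split `Π_w Q_w ≃ (Π_{p} Q_w) × (Π_{¬p} Q_w)` (measure preserving, ★ (A1) §0) and apply Fubini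
  have hψ' := (measurePreserving_piEquivPiSubtypeProd'
    (fun w : {w : InfinitePlace L // IsComplex w} => quotientMeasure (chartTorusGLoc L α w S') (t w) (isClosed_chartTorusGLoc L α w S') (ν'w w)) p).symm
    (MeasurableEquiv.piEquivPiSubtypeProd
      (fun w : {w : InfinitePlace L // IsComplex w} => ↥(archLocal L 3 (Matrix.diagonal α) w) ⧸ chartTorusGLoc L α w S') p)
  have h2 := (hψ'.integral_comp' F).symm
  have hFi' : Integrable (fun q => F ((MeasurableEquiv.piEquivPiSubtypeProd
      (fun w : {w : InfinitePlace L // IsComplex w} => ↥(archLocal L 3 (Matrix.diagonal α) w) ⧸ chartTorusGLoc L α w S') p).symm q)) _ :=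
    (hψ'.integrable_comp_emb (MeasurableEquiv.measurableEmbedding _)).mpr hint
  rw [show (∫ x, a' ((archPiEquivCM 3 L (Matrix.diagonal α)).symm fun w =>
      descConj (gprimeBlockAt L α w S' (c w)) (chartTorusGLoc L α w S') (forall_mem_chartTorusGLoc_comm L α w S' (c w)) id (x w))
      ∂(Measure.pi fun w => quotientMeasure (chartTorusGLoc L α w S') (t w) (isClosed_chartTorusGLoc L α w S') (ν'w w))) =
      ∫ x, F x ∂(Measure.pi fun w => quotientMeasure (chartTorusGLoc L α w S') (t w) (isClosed_chartTorusGLoc L α w S') (ν'w w)) from rfl,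
    h2, integral_prod _ hFi']

include hν in
/-- **(J-iso)^T AT A REGULAR POINT, BINDER-FREE**: for admissible `S′`, ANY decidable predicate `p` on the places, `c ∈ RegG S′` and `a′ ∈ C_c(G′_∞)`,
`chartOrbG ν′ S′ a′ c = (Π_w t_w(B′_w)) · ∫_{Π_{p}(U_w⧸T′_w)} ( ∫_{Π_{¬p}(U_w⧸T′_w)} a′ (e⁻¹ (z_w γ_w(c) z_w⁻¹)_w) d(⊗_{¬p} ν′_w∕t_w) ) d(⊗_{p} ν′_w∕t_w)`
(§1 with its `Integrable` binder discharged by ★ (A1) `integrable_comp_symm_archPiEquivCM_descConj_pi_of_regG`).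
[cite: Rogawski1990, §8.2 p. 122; §8.3 pp. 122–124] [cite: Folland1995, §2.6 (2.52)] [cite: DeitmarEchterhoff2014, Lemma 9.3.3] -/
theorem chartOrbG_eq_prod_mul_integral_integral_isolate_pred_of_regG (hα : ∀ i, α i ≠ 0) (hS' : ∀ w, w ∈ S' → w ∈ splitChartPlaces L α)
    {c : {w : InfinitePlace L // IsComplex w} → Fin 3 → ℝ} (hc : c ∈ ArchCartan.RegG S')
    {a' : ↥(arch (↥(maximalRealSubfield L)) L (IsCMField.complexConj L) 3 (Matrix.diagonal α)) → ℂ} (ha'c : Continuous a') (ha's : HasCompactSupport a') :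
    chartOrbG L α ν' S' a' c =
      (∏ w, ((t w (chartBoxImgGLoc L α w S')).toReal : ℂ)) *
        ∫ y : (∀ w : {w : {w : InfinitePlace L // IsComplex w} // p w}, ↥(archLocal L 3 (Matrix.diagonal α) w.1) ⧸ chartTorusGLoc L α w.1 S'),
          (∫ b : (∀ w' : {w : {w : InfinitePlace L // IsComplex w} // ¬ p w}, ↥(archLocal L 3 (Matrix.diagonal α) w'.1) ⧸ chartTorusGLoc L α w'.1 S'),
            a' ((archPiEquivCM 3 L (Matrix.diagonal α)).symm fun w =>
              descConj (gprimeBlockAt L α w S' (c w)) (chartTorusGLoc L α w S') (forall_mem_chartTorusGLoc_comm L α w S' (c w)) id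
                ((MeasurableEquiv.piEquivPiSubtypeProd
                    (fun w : {w : InfinitePlace L // IsComplex w} => ↥(archLocal L 3 (Matrix.diagonal α) w) ⧸ chartTorusGLoc L α w S') p).symm (y, b) w))
            ∂(Measure.pi fun w' : {w : {w : InfinitePlace L // IsComplex w} // ¬ p w} =>
                quotientMeasure (chartTorusGLoc L α w'.1 S') (t w'.1) (isClosed_chartTorusGLoc L α w'.1 S') (ν'w w'.1)))
          ∂(Measure.pi fun w : {w : {w : InfinitePlace L // IsComplex w} // p w} =>
                quotientMeasure (chartTorusGLoc L α w.1 S') (t w.1) (isClosed_chartTorusGLoc L α w.1 S') (ν'w w.1)) :=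
  chartOrbG_eq_prod_mul_integral_integral_isolate_pred L α S' ν'w ν' hν t p hα hS'
    (integrable_comp_symm_archPiEquivCM_descConj_pi_of_regG L α S' ν'w ν' hν t hα hS' hc ha'c ha's)

/-! ## §2 The group form at COMPACT-chart places `p w → w ∉ S′`: ONE whole-group orbital integral over `Π_{p} U(α)_w` of the partial chart-orbital integral -/

/-- The inverse of Mathlib's `piEquivPiSubtypeProd`, read componentwise (definitional; as in ★ `ArchTorusOrbitalFubini` §4, ★ (J-iso) §2). [cite: BorelJacquet1979, §4.1] -/
private theorem piEquivPiSubtypeProd_symm_apply_dite'' {ι : Type*} (π : ι → Type*) [∀ i, MeasurableSpace (π i)] (q : ι → Prop)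
    [DecidablePred q] (a : ∀ i : Subtype q, π i) (b : ∀ i : {i // ¬ q i}, π i) (i : ι) :
    (MeasurableEquiv.piEquivPiSubtypeProd π q).symm (a, b) i = if h : q i then a ⟨i, h⟩ else b ⟨i, h⟩ := rfl

omit [∀ w : {w : InfinitePlace L // IsComplex w}, BorelSpace ↥(archLocal L 3 (Matrix.diagonal α) w)]
  [∀ w : {w : InfinitePlace L // IsComplex w}, LocallyCompactSpace ↥(archLocal L 3 (Matrix.diagonal α) w)]
  [∀ w : {w : InfinitePlace L // IsComplex w}, SecondCountableTopology ↥(archLocal L 3 (Matrix.diagonal α) w)]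
  [∀ w : {w : InfinitePlace L // IsComplex w}, BorelSpace (↥(archLocal L 3 (Matrix.diagonal α) w) ⧸ chartTorusGLoc L α w S')]
  [MeasurableSpace ↥(arch (↥(maximalRealSubfield L)) L (IsCMField.complexConj L) 3 (Matrix.diagonal α))]
  [BorelSpace ↥(arch (↥(maximalRealSubfield L)) L (IsCMField.complexConj L) 3 (Matrix.diagonal α))]
  [Fintype {w : {w : InfinitePlace L // IsComplex w} // p w}] [Fintype {w : {w : InfinitePlace L // IsComplex w} // ¬ p w}] in
/-- **REASSEMBLY THROUGH `descConj … id`**: conjugating the assembled QUOTIENT family `(y, b)` place by place by the base points `γ_w(c)` gives the assembled GROUP family of the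
conjugated pieces `((ẏ_w γ_w(c) ẏ_w⁻¹)_{p}, (ḃ_{w′} γ_{w′}(c) ḃ_{w′}⁻¹)_{¬p})` (the assembly = Mathlib `piEquivPiSubtypeProd … p` on the groups `U(α)_w`).
[cite: BorelJacquet1979, §4.1] [cite: Rogawski1990, §8.2 p. 122] -/
theorem descConj_assembleQuotient_pred_eq (c : {w : InfinitePlace L // IsComplex w} → Fin 3 → ℝ)
    (y : ∀ w : {w : {w : InfinitePlace L // IsComplex w} // p w}, ↥(archLocal L 3 (Matrix.diagonal α) w.1) ⧸ chartTorusGLoc L α w.1 S')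
    (b : ∀ w' : {w : {w : InfinitePlace L // IsComplex w} // ¬ p w}, ↥(archLocal L 3 (Matrix.diagonal α) w'.1) ⧸ chartTorusGLoc L α w'.1 S') :
    (fun w => descConj (gprimeBlockAt L α w S' (c w)) (chartTorusGLoc L α w S') (forall_mem_chartTorusGLoc_comm L α w S' (c w)) id
        ((MeasurableEquiv.piEquivPiSubtypeProd
            (fun w : {w : InfinitePlace L // IsComplex w} => ↥(archLocal L 3 (Matrix.diagonal α) w) ⧸ chartTorusGLoc L α w S') p).symm (y, b) w)) =
      (MeasurableEquiv.piEquivPiSubtypeProd (fun w : {w : InfinitePlace L // IsComplex w} => ↥(archLocal L 3 (Matrix.diagonal α) w)) p).symm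
        (fun w => descConj (gprimeBlockAt L α w.1 S' (c w.1)) (chartTorusGLoc L α w.1 S') (forall_mem_chartTorusGLoc_comm L α w.1 S' (c w.1)) id (y w),
          fun w' => descConj (gprimeBlockAt L α w'.1 S' (c w'.1)) (chartTorusGLoc L α w'.1 S') (forall_mem_chartTorusGLoc_comm L α w'.1 S' (c w'.1)) id (b w')) := by
  funext w
  rw [piEquivPiSubtypeProd_symm_apply_dite'', piEquivPiSubtypeProd_symm_apply_dite'']
  by_cases h : p w
  · rw [dif_pos h, dif_pos h]
  · rw [dif_neg h, dif_neg h]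

include hν in
/-- **(J-iso)^T, GROUP FORM AT COMPACT PLACES — THE `p`-PLACES ARE ONE WHOLE-GROUP ORBITAL INTEGRAL OF THE PARTIAL CHART-ORBITAL INTEGRAL OVER THE OTHER PLACES.**
For admissible `S′`, a decidable predicate `p` selecting COMPACT-chart places only (`hp : p w → w ∉ S′`, so every `T′_{S′,w}`, `p w`, is compact, ★
`compactSpace_chartTorusGLoc_of_not_mem`), `c ∈ RegG S′` and `a′ ∈ C_c(G′_∞)`:
`chartOrbG ν′ S′ a′ c = (Π_{¬p} t_w(B′_w)) · ∫_{Π_{p} U(α)_w} Θ_c((g_w · γ_w(c) · g_w⁻¹)_{p}) d(⊗_{p} ν′_w)(g)`, where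
`Θ_c(x) = ∫_{Π_{¬p}(U_w⧸T′_w)} a′ (e⁻¹ (x, (ḃ_w γ_w(c) ḃ_w⁻¹)_{¬p})) d(⊗_{¬p} ν′_w∕t_w)` is the partial chart-orbital integral over the other places read at the group family
`x ∈ Π_{p} U(α)_w` (the lambda below; assembly by `piEquivPiSubtypeProd … p` on the groups).  The torus measures `t_w`, `p w`, are GONE: their box factors `t_w(B′_w) = t_w(T′_w)`
(★ `chartBoxImgGLoc_eq_univ_of_not_mem`) cancel the `(Π_{p} t_w(T′_w))⁻¹` of §0 `integral_pi_quotientMeasure_eq_inv_smul_integral_pi` (= ★ `quotientMeasure_eq_inv_smul_map_mk` under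
`Measure.pi`: all isolated places convert AT ONCE).  (Measurability of `Θ_c`: Mathlib `StronglyMeasurable.integral_prod_right'` on the continuous integrand.)  The one-place case
`p := (· = w₀)` is ★ (J-iso) `chartOrbG_eq_prod_mul_integral_group_isolate_of_not_mem` (up to `piUnique`).
[cite: Folland1995, §2.2; §2.6 Thm. 2.49, (2.52)] [cite: Rogawski1990, §8.2 p. 122; §8.3 p. 124] [cite: DeitmarEchterhoff2014, Cor. 1.5.4; Lemma 9.3.3] [cite: BorelJacquet1979, §4.1] -/
theorem chartOrbG_eq_prod_mul_integral_pi_group_isolate_of_forall_not_mem (hα : ∀ i, α i ≠ 0) (hS' : ∀ w, w ∈ S' → w ∈ splitChartPlaces L α)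
    (hp : ∀ w, p w → w ∉ S')
    {c : {w : InfinitePlace L // IsComplex w} → Fin 3 → ℝ} (hc : c ∈ ArchCartan.RegG S')
    {a' : ↥(arch (↥(maximalRealSubfield L)) L (IsCMField.complexConj L) 3 (Matrix.diagonal α)) → ℂ} (ha'c : Continuous a') (ha's : HasCompactSupport a') :
    chartOrbG L α ν' S' a' c =
      (∏ w' : {w : {w : InfinitePlace L // IsComplex w} // ¬ p w}, ((t w'.1 (chartBoxImgGLoc L α w'.1 S')).toReal : ℂ)) *
        ∫ g : (∀ w : {w : {w : InfinitePlace L // IsComplex w} // p w}, ↥(archLocal L 3 (Matrix.diagonal α) w.1)),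
          (∫ b : (∀ w' : {w : {w : InfinitePlace L // IsComplex w} // ¬ p w}, ↥(archLocal L 3 (Matrix.diagonal α) w'.1) ⧸ chartTorusGLoc L α w'.1 S'),
            a' ((archPiEquivCM 3 L (Matrix.diagonal α)).symm
              ((MeasurableEquiv.piEquivPiSubtypeProd (fun w : {w : InfinitePlace L // IsComplex w} => ↥(archLocal L 3 (Matrix.diagonal α) w)) p).symm
                (fun w => g w * gprimeBlockAt L α w.1 S' (c w.1) * (g w)⁻¹,
                  fun w' => descConj (gprimeBlockAt L α w'.1 S' (c w'.1)) (chartTorusGLoc L α w'.1 S') (forall_mem_chartTorusGLoc_comm L α w'.1 S' (c w'.1)) id (b w'))))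
            ∂(Measure.pi fun w' : {w : {w : InfinitePlace L // IsComplex w} // ¬ p w} =>
                quotientMeasure (chartTorusGLoc L α w'.1 S') (t w'.1) (isClosed_chartTorusGLoc L α w'.1 S') (ν'w w'.1)))
          ∂(Measure.pi fun w : {w : {w : InfinitePlace L // IsComplex w} // p w} => ν'w w.1) := by
  haveI : ∀ w : {w : InfinitePlace L // IsComplex w}, IsClosed (chartTorusGLoc L α w S' : Set ↥(archLocal L 3 (Matrix.diagonal α) w)) :=
    fun w => isClosed_chartTorusGLoc L α w S'
  haveI : ∀ w : {w : InfinitePlace L // IsComplex w}, SecondCountableTopology (↥(archLocal L 3 (Matrix.diagonal α) w) ⧸ chartTorusGLoc L α w S') := fun w => inferInstance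
  haveI : ∀ w : {w : InfinitePlace L // IsComplex w},
      SigmaFinite (quotientMeasure (chartTorusGLoc L α w S') (t w) (isClosed_chartTorusGLoc L α w S') (ν'w w)) := fun w => inferInstance
  haveI : ∀ w, LocallyCompactSpace ↥(chartTorusGLoc L α w S') := fun w => locallyCompactSpace_chartTorusGLoc L α w S'
  haveI : ∀ w, SecondCountableTopology ↥(chartTorusGLoc L α w S') := fun w => TopologicalSpace.Subtype.secondCountableTopology _
  haveI : ∀ w, SigmaFinite (t w) := fun w => inferInstance
  haveI : ∀ w : {w : {w : InfinitePlace L // IsComplex w} // p w}, CompactSpace ↥(chartTorusGLoc L α w.1 S') :=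
    fun w => compactSpace_chartTorusGLoc_of_not_mem L α w.1 S' hα hS' (hp w.1 w.2)
  rw [chartOrbG_eq_prod_mul_integral_integral_isolate_pred_of_regG L α S' ν'w ν' hν t p hα hS' hc ha'c ha's]
  -- the partial chart-orbital integral over the places `¬ p w′`, as a function on the GROUP family `Π_{p} U(α)_w`
  set Θ : (∀ w : {w : {w : InfinitePlace L // IsComplex w} // p w}, ↥(archLocal L 3 (Matrix.diagonal α) w.1)) → ℂ := fun x =>
    ∫ b : (∀ w' : {w : {w : InfinitePlace L // IsComplex w} // ¬ p w}, ↥(archLocal L 3 (Matrix.diagonal α) w'.1) ⧸ chartTorusGLoc L α w'.1 S'),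
      a' ((archPiEquivCM 3 L (Matrix.diagonal α)).symm
        ((MeasurableEquiv.piEquivPiSubtypeProd (fun w : {w : InfinitePlace L // IsComplex w} => ↥(archLocal L 3 (Matrix.diagonal α) w)) p).symm
          (x, fun w' => descConj (gprimeBlockAt L α w'.1 S' (c w'.1)) (chartTorusGLoc L α w'.1 S') (forall_mem_chartTorusGLoc_comm L α w'.1 S' (c w'.1)) id (b w'))))
      ∂(Measure.pi fun w' : {w : {w : InfinitePlace L // IsComplex w} // ¬ p w} =>
          quotientMeasure (chartTorusGLoc L α w'.1 S') (t w'.1) (isClosed_chartTorusGLoc L α w'.1 S') (ν'w w'.1)) with hΘ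
  -- the outer integrand of §1 is `Θ` read at the place-by-place conjugated quotient family
  have hout : (fun y : (∀ w : {w : {w : InfinitePlace L // IsComplex w} // p w}, ↥(archLocal L 3 (Matrix.diagonal α) w.1) ⧸ chartTorusGLoc L α w.1 S') =>
      ∫ b : (∀ w' : {w : {w : InfinitePlace L // IsComplex w} // ¬ p w}, ↥(archLocal L 3 (Matrix.diagonal α) w'.1) ⧸ chartTorusGLoc L α w'.1 S'),
        a' ((archPiEquivCM 3 L (Matrix.diagonal α)).symm fun w =>
          descConj (gprimeBlockAt L α w S' (c w)) (chartTorusGLoc L α w S') (forall_mem_chartTorusGLoc_comm L α w S' (c w)) id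
            ((MeasurableEquiv.piEquivPiSubtypeProd
                (fun w : {w : InfinitePlace L // IsComplex w} => ↥(archLocal L 3 (Matrix.diagonal α) w) ⧸ chartTorusGLoc L α w S') p).symm (y, b) w))
        ∂(Measure.pi fun w' : {w : {w : InfinitePlace L // IsComplex w} // ¬ p w} =>
            quotientMeasure (chartTorusGLoc L α w'.1 S') (t w'.1) (isClosed_chartTorusGLoc L α w'.1 S') (ν'w w'.1))) =
      fun y => Θ (fun w => descConj (gprimeBlockAt L α w.1 S' (c w.1)) (chartTorusGLoc L α w.1 S') (forall_mem_chartTorusGLoc_comm L α w.1 S' (c w.1)) id (y w)) := by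
    funext y
    rw [hΘ]
    refine integral_congr_ae (Filter.Eventually.of_forall fun b => ?_)
    simp only []
    rw [descConj_assembleQuotient_pred_eq L α S' p c y b]
  rw [hout]
  -- `Θ` is Borel: it is the partial integral of a CONTINUOUS integrand on `(Π_{p} U(α)_w) × Π_{¬p} (U_{w′} ⧸ T′_{w′})`
  have hΘm : Measurable Θ := by
    have hcont : Continuous fun q : (∀ w : {w : {w : InfinitePlace L // IsComplex w} // p w}, ↥(archLocal L 3 (Matrix.diagonal α) w.1)) ×
        (∀ w' : {w : {w : InfinitePlace L // IsComplex w} // ¬ p w}, ↥(archLocal L 3 (Matrix.diagonal α) w'.1) ⧸ chartTorusGLoc L α w'.1 S') =>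
        a' ((archPiEquivCM 3 L (Matrix.diagonal α)).symm
          ((MeasurableEquiv.piEquivPiSubtypeProd (fun w : {w : InfinitePlace L // IsComplex w} => ↥(archLocal L 3 (Matrix.diagonal α) w)) p).symm
            (q.1, fun w' => descConj (gprimeBlockAt L α w'.1 S' (c w'.1)) (chartTorusGLoc L α w'.1 S') (forall_mem_chartTorusGLoc_comm L α w'.1 S' (c w'.1)) id (q.2 w')))) := by
      refine ha'c.comp ((archPiEquivCM 3 L (Matrix.diagonal α)).symm.continuous.comp ?_)
      have hsymm : Continuous (MeasurableEquiv.piEquivPiSubtypeProd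
          (fun w : {w : InfinitePlace L // IsComplex w} => ↥(archLocal L 3 (Matrix.diagonal α) w)) p).symm :=
        (Homeomorph.piEquivPiSubtypeProd p (fun w : {w : InfinitePlace L // IsComplex w} => ↥(archLocal L 3 (Matrix.diagonal α) w))).symm.continuous
      refine hsymm.comp (continuous_fst.prodMk (continuous_pi fun w' => ?_))
      exact (continuous_descConj (gprimeBlockAt L α w'.1 S' (c w'.1)) (chartTorusGLoc L α w'.1 S') (forall_mem_chartTorusGLoc_comm L α w'.1 S' (c w'.1))
        continuous_id).comp ((continuous_apply w').comp continuous_snd)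
    exact hcont.stronglyMeasurable.integral_prod_right'.measurable
  -- the place-by-place conjugation of the quotient family is Borel
  have hdesc : Measurable fun (y : ∀ w : {w : {w : InfinitePlace L // IsComplex w} // p w}, ↥(archLocal L 3 (Matrix.diagonal α) w.1) ⧸ chartTorusGLoc L α w.1 S')
      (w : {w : {w : InfinitePlace L // IsComplex w} // p w}) =>
      descConj (gprimeBlockAt L α w.1 S' (c w.1)) (chartTorusGLoc L α w.1 S') (forall_mem_chartTorusGLoc_comm L α w.1 S' (c w.1)) id (y w) :=
    measurable_pi_iff.mpr fun w => (measurable_descConj (gprimeBlockAt L α w.1 S' (c w.1)) (chartTorusGLoc L α w.1 S')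
      (forall_mem_chartTorusGLoc_comm L α w.1 S' (c w.1)) measurable_id).comp (measurable_pi_apply w)
  rw [integral_pi_quotientMeasure_eq_inv_smul_integral_pi (fun w : {w : {w : InfinitePlace L // IsComplex w} // p w} => chartTorusGLoc L α w.1 S')
      (fun w => isClosed_chartTorusGLoc L α w.1 S') (fun w => t w.1) (fun w => ν'w w.1)
      (fun y => Θ (fun w => descConj (gprimeBlockAt L α w.1 S' (c w.1)) (chartTorusGLoc L α w.1 S') (forall_mem_chartTorusGLoc_comm L α w.1 S' (c w.1)) id (y w)))
      ((hΘm.comp hdesc).stronglyMeasurable)]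
  simp only [descConj_mk, id_eq]
  -- constants: `Π_w t_w(B′_w) = (Π_{p} t_w(B′_w)) · Π_{¬p} t_w(B′_w)`, `B′_w = T′_w` at `p w` (whole torus at `w ∉ S′`), cancel against `(Π_{p} t_w(T′))⁻¹`
  have hsplit : (∏ w, ((t w (chartBoxImgGLoc L α w S')).toReal : ℂ)) =
      (∏ w : {w : {w : InfinitePlace L // IsComplex w} // p w}, ((t w.1 (chartBoxImgGLoc L α w.1 S')).toReal : ℂ)) *
        ∏ w' : {w : {w : InfinitePlace L // IsComplex w} // ¬ p w}, ((t w'.1 (chartBoxImgGLoc L α w'.1 S')).toReal : ℂ) := by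
    convert (Fintype.prod_subtype_mul_prod_subtype p (fun w => ((t w (chartBoxImgGLoc L α w S')).toReal : ℂ))).symm
  have huniv : (∏ w : {w : {w : InfinitePlace L // IsComplex w} // p w}, ((t w.1 (chartBoxImgGLoc L α w.1 S')).toReal : ℂ)) =
      ((∏ w : {w : {w : InfinitePlace L // IsComplex w} // p w}, (t w.1).real Set.univ : ℝ) : ℂ) := by
    rw [Complex.ofReal_prod]
    exact Finset.prod_congr rfl fun w _ => by rw [chartBoxImgGLoc_eq_univ_of_not_mem L α w.1 S' hα hS' (hp w.1 w.2), measureReal_def]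
  have hpos : (∏ w : {w : {w : InfinitePlace L // IsComplex w} // p w}, (t w.1).real Set.univ : ℝ) ≠ 0 :=
    Finset.prod_ne_zero_iff.mpr fun w _ =>
      (ENNReal.toReal_pos (isOpen_univ.measure_pos (t w.1) Set.univ_nonempty).ne' (isCompact_univ.measure_lt_top).ne).ne'
  rw [hsplit, huniv, Complex.real_smul, Complex.ofReal_inv, mul_assoc, mul_left_comm _ ((↑(∏ w : {w : {w : InfinitePlace L // IsComplex w} // p w}, (t w.1).real Set.univ))⁻¹ : ℂ),
    ← mul_assoc, mul_inv_cancel₀ (Complex.ofReal_ne_zero.mpr hpos), one_mul]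

end Isolate

end Literature.NumberTheory.Automorphic.UnitaryGroup

end
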